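import Mathlib
import Summits.Ventures.PercRepro2.Tail2DBlockCalc
import Summits.Ventures.PercRepro2.Tail2DHarrisSP
import Summits.Ventures.PercRepro2.Tail2DFlowOneBlocks
import Summits.Ventures.PercRepro2.Tail2DDisjointPaths

/-!
# The colour-swap duality of (SD), and the positions where (SD) is Harris's inequality
(seat mine-b, cell pub-perc-repro2; conjectures/MINE-B.md §43)

The colour swap `swapConf` (every edge red ↔ blue) is an order-REVERSING involution of the configuration
poset of every SP term which exchanges the two flows (`rLab_swapConf`, `bLab_swapConf`).  A block domination
`A ≼ A'` is therefore reflected: `Unif(swap A') ≼ Unif(swap A)` (`blockDom_swap`) — for a monotone weight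
`f` the weight `f ∘ swap` is antitone, and an antitone weight is a constant minus a monotone one.  On the tails
this is **the duality (SD)(u,v) ⟺ (SD)(v+1, u−1)** (`sdomZ_swap`, `sdomZ_swap_iff`): the member
`E(u,v) ≼ E(u−1,v+1)` of the family and its mirror image `E(v+1,u−1) ≼ E(v,u)` are the same statement.
Every census and every proof of the family needs only one side of the diagonal `u = v + 1`.

The second part records the positions where (SD) is Harris's inequality alone, on EVERY SP term: for `u ≤ 1`
and `v ≤ 0` the clipped tail `E(u,v) ∈ {all, {r ≥ 1}}` is a lower set and the clipped target
`E(u−1,v+1) ∈ {all, {b ≥ 1}}` is an upper set, so `sdomZ_of_le_one` follows from `blockDom_lower_upper`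
(and its degenerate forms).  In particular the member `(1,0)` — `{r ≥ 1} ≼ {b ≥ 1}` — holds on every pin-free
pattern (`sdomZ_one_zero`); the three-block certificate `cert_10` of `Tail2DFlowOnePar.lean` is not needed.
-/

namespace Summit.Ventures.PercRepro2.Tail2D

open V2Closure Finset

section Swap

/-- the colour swap reverses the configuration order -/
theorem swapConf_antitone : ∀ (s : V2Closure.SP) (x y : s.Conf), x ≤ y → swapConf s y ≤ swapConf s x
  | .free, x, y, hxy => by
      cases x <;> cases y <;> first | (simp [swapConf]; done) | simpa [swapConf] using hxy
  | .pin, _, _, _ => le_rfl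
  | .absent, _, _, _ => le_rfl
  | .ser s t, x, y, hxy => ⟨swapConf_antitone s x.1 y.1 hxy.1, swapConf_antitone t x.2 y.2 hxy.2⟩
  | .par s t, x, y, hxy => ⟨swapConf_antitone s x.1 y.1 hxy.1, swapConf_antitone t x.2 y.2 hxy.2⟩

variable (s : V2Closure.SP)

/-- the colour swap is injective (it is an involution) -/
theorem swapConf_injective : Function.Injective (swapConf s) := by
  intro x y hxy
  have := congrArg (swapConf s) hxy
  rwa [swapConf_swapConf, swapConf_swapConf] at this

/-- membership in the swapped block `A.image swap` -/
theorem mem_image_swap (A : Finset s.Conf) (x : s.Conf) : x ∈ A.image (swapConf s) ↔ swapConf s x ∈ A := by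
  rw [Finset.mem_image]
  constructor
  · rintro ⟨y, hy, rfl⟩
    rwa [swapConf_swapConf]
  · intro hx
    exact ⟨swapConf s x, hx, swapConf_swapConf s x⟩

/-- the swap preserves the size of a block -/
theorem card_image_swap (A : Finset s.Conf) : (A.image (swapConf s)).card = A.card :=
  Finset.card_image_of_injective A (swapConf_injective s)

/-- the block sum over a swapped block is the block sum of the swapped weight -/
theorem blockSum_image_swap (A : Finset s.Conf) (f : s.Conf → ℕ) :
    blockSum s (A.image (swapConf s)) f = blockSum s A (fun x => f (swapConf s x)) := by
  unfold blockSum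
  exact Finset.sum_image (fun x _ y _ h => swapConf_injective s h)

/-- **a block domination reflected by the colour swap**: `A ≼ A'` gives `swap A' ≼ swap A` — the weight
`f ∘ swap` is antitone, and `M − f ∘ swap` is monotone for a bound `M` of `f` -/
theorem blockDom_swap {A A' : Finset s.Conf} (h : BlockDom s A A') :
    BlockDom s (A'.image (swapConf s)) (A.image (swapConf s)) := by
  intro f hf
  rw [blockSum_image_swap, blockSum_image_swap, card_image_swap, card_image_swap]
  set g : s.Conf → ℕ := fun x => f (swapConf s x) with hg
  set M : ℕ := ∑ x, g x with hM
  have hgM : ∀ x, g x ≤ M := fun x =>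
    Finset.single_le_sum (fun y _ => Nat.zero_le (g y)) (Finset.mem_univ x)
  have hmono : Monotone (fun x => M - g x) := by
    intro x y hxy
    have : g y ≤ g x := hf (swapConf_antitone s x y hxy)
    exact Nat.sub_le_sub_left this M
  have key := h (fun x => M - g x) hmono
  have e : ∀ B : Finset s.Conf, blockSum s B (fun x => M - g x) + blockSum s B g = M * B.card := by
    intro B
    unfold blockSum
    rw [← Finset.sum_add_distrib]
    rw [Finset.sum_congr rfl (fun x _ => Nat.sub_add_cancel (hgM x))]
    rw [Finset.sum_const, smul_eq_mul, mul_comm]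
  have eA := e A; have eA' := e A'
  unfold blockSum at key eA eA' ⊢
  nlinarith [key, eA, eA']

/-- the swap of a tail set is the mirrored tail set -/
theorem image_swap_tailSet (a c : ℕ) : (tailSet s a c).image (swapConf s) = tailSet s c a := by
  ext x
  rw [mem_image_swap]
  simp only [tailSet, Finset.mem_filter, Finset.mem_univ, true_and, rLab_swapConf, bLab_swapConf]
  exact and_comm

/-- **the colour-swap duality of (SD)**: the member `(u,v)` gives the member `(v+1, u−1)` -/
theorem sdomZ_swap {u v : ℤ} (h : SDomZ s u v) : SDomZ s (v + 1) (u - 1) := by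
  rw [sdomZ_iff_blockDom] at h ⊢
  have e1 : (v + 1 - 1 : ℤ) = v := by ring
  have e2 : (u - 1 + 1 : ℤ) = u := by ring
  rw [e1, e2]
  have := blockDom_swap s h
  rwa [image_swap_tailSet, image_swap_tailSet] at this

/-- the duality both ways: `(SD)(u,v) ⟺ (SD)(v+1, u−1)` -/
theorem sdomZ_swap_iff (u v : ℤ) : SDomZ s u v ↔ SDomZ s (v + 1) (u - 1) := by
  constructor
  · exact sdomZ_swap s
  · intro h
    have := sdomZ_swap s h
    have e1 : (u - 1 + 1 : ℤ) = u := by ring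
    have e2 : (v + 1 - 1 : ℤ) = v := by ring
    rwa [e1, e2] at this

end Swap

section Harris

variable (s : V2Closure.SP)

/-- the red tails `{r ≥ a}` are lower sets -/
theorem tailSet_zero_right_lower (a : ℕ) : ∀ x y : s.Conf, x ≤ y → y ∈ tailSet s a 0 → x ∈ tailSet s a 0 := by
  intro x y hxy hy
  simp only [tailSet, Finset.mem_filter, Finset.mem_univ, true_and] at hy ⊢
  exact ⟨le_trans hy.1 (rLab_antitone s hxy), Nat.zero_le _⟩

/-- the blue tails `{b ≥ c}` are upper sets -/
theorem tailSet_zero_left_upper (c : ℕ) : ∀ x y : s.Conf, x ≤ y → x ∈ tailSet s 0 c → y ∈ tailSet s 0 c := by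
  intro x y hxy hx
  simp only [tailSet, Finset.mem_filter, Finset.mem_univ, true_and] at hx ⊢
  exact ⟨Nat.zero_le _, le_trans hx.2 (bLab_monotone s hxy)⟩

/-- the tail `E(0,0)` is everything -/
theorem tailSet_zero_zero : tailSet s 0 0 = Finset.univ := by
  ext x; simp [tailSet]

/-- **(SD) at every clipped position with `u ≤ 1` and `v ≤ 0` is Harris's inequality**: the source is a lower
set (`all` or `{r ≥ 1}`) and the target an upper set (`all` or `{b ≥ 1}`) — on EVERY SP term -/
theorem sdomZ_of_le_one (u v : ℤ) (hu : u ≤ 1) (hv : v ≤ 0) : SDomZ s u v := by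
  rw [sdomZ_iff_blockDom]
  have hv0 : v.toNat = 0 := by omega
  have hu1 : (u - 1).toNat = 0 := by omega
  rw [hv0, hu1]
  have hsrc : ∀ x y : s.Conf, x ≤ y → y ∈ tailSet s u.toNat 0 → x ∈ tailSet s u.toNat 0 :=
    tailSet_zero_right_lower s _
  have htgt : ∀ x y : s.Conf, x ≤ y → x ∈ tailSet s 0 (v + 1).toNat → y ∈ tailSet s 0 (v + 1).toNat :=
    tailSet_zero_left_upper s _
  exact blockDom_lower_upper s _ _ hsrc htgt

/-- **the member `(1,0)` of (SD) on every SP term**: `{r ≥ 1} ≼ {b ≥ 1}` -/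
theorem sdomZ_one_zero : SDomZ s 1 0 := sdomZ_of_le_one s 1 0 le_rfl le_rfl

/-- the member `(1,0)` in `ℕ`-form: for every monotone weight `f`, `Σ_f(1,0) · T(0,1) ≤ Σ_f(0,1) · T(1,0)` -/
theorem sdom_one_zero (f : s.Conf → ℕ) (hf : Monotone f) :
    tailSum s f 1 0 * tailCount s 0 1 ≤ tailSum s f 0 1 * tailCount s 1 0 := sdomZ_one_zero s f hf

end Harris

end Summit.Ventures.PercRepro2.Tail2D
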